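import Literature.MathematicalPhysics.KineticTheory.LangevinChainFlowBounds
import Literature.MathematicalPhysics.KineticTheory.LangevinChainLaSalle

/-!
# Common-noise differences of the flow of the pinned chain: componentwise integral equations and force Lipschitz bounds

Helper (`--supports`) for the line `contact-current-forgetting` of the crux `JunctionLocality.NonBallistic`
(stmt-AtomisticToContinuum-9127), stub `stub_lightConeWindow` (LC), piece FS-A (the deterministic common-noise
propagation bound `chainFlow_momentumFlip_propagation`, file `…NonBallisticLightConePropagation`). Pathwise facts for the
flow `z = chainFlow x η` of the pinned anharmonic chain `pinnedChain ω₂ lam β γ` (`U'(q) = ω₂ q + lam q³`,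
`V'(r) = r + β r³`, friction `γ w_i`, `w_i = [i = 0] + [i = N-1]`) driven by a continuous momentum-noise path `η`
(`LangevinChainSDE.lean`, integral equation `z(t) = x + (0, η t) + ∫₀ᵗ Y(z)`):

* `pinnedChain_chainFlow_fst_apply` / `pinnedChain_chainFlow_snd_apply` — the components of the integral equation,
  `q_i(t) = q_i(0) + ∫₀ᵗ p_i`, `p_i(t) = p_i(0) + η_i(t) + ∫₀ᵗ Y(z)_{p,i}` (general `η`; the tree's
  `pinnedChain_freeFlow_fst_eq` / `_snd_eq` of `LangevinChainLaSalle.lean` are the case `η = 0`);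
* `pinnedChain_chainFlow_sub_apply` — THE NOISE CANCELS IN DIFFERENCES: for two initial data `x, x'` and the SAME `η`,
  `δq_i(t) = δq_i(0) + ∫₀ᵗ δp_i`, `δp_i(t) = δp_i(0) + ∫₀ᵗ (Y(z')_{p,i} - Y(z)_{p,i})`;
* `pinnedChain_abs_dPotential_sub_le` / `pinnedChain_abs_drift_snd_sub_le` — on the box `{|q_j| ≤ R}` the
  nearest-neighbour cubic force is Lipschitz with constants `O(R²)`:
  `|Y(z')_{p,i} - Y(z)_{p,i}| ≤ (ω₂ + 3 lam R² + 2(1 + 12 β R²) + 2γ) d_i + (1 + 12 β R²)(d_{i-1} + d_{i+1})` for any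
  nonnegative lattice function `d : ℤ → ℝ` dominating the site deviations (sites off the chain carry no constraint);
* `latticeSum_*` — bookkeeping for the extension by zero `Fin N ↪ ℤ` of site functions, the format of the abstract
  Dobrushin–Fritz iteration `BMLightCone.lattice_iteration_far` (`InfiniteChainLightConeProofs.lean`).
-/

noncomputable section

open MeasureTheory Set Filter Topology

namespace Summit.AtomisticToContinuum.FouriersLaw.Theorems.NonBallistic

open Literature.MathematicalPhysics.KineticTheory.HeatConduction

namespace LightConePropagation

variable {N : ℕ} {ω₂ lam β γ : ℝ}

/-! ### Elementary Lipschitz bounds for the cubic forces -/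

/-- `|(c₁ a + c₃ a³) - (c₁ b + c₃ b³)| ≤ (c₁ + 3 c₃ R²) |a - b|` for `|a|, |b| ≤ R`, `c₁, c₃ ≥ 0`
(`a³ - b³ = (a - b)(a² + ab + b²)`). [folklore] -/
theorem abs_cubic_sub_cubic_le {c₁ c₃ R a b : ℝ} (hc₁ : 0 ≤ c₁) (hc₃ : 0 ≤ c₃)
    (ha : |a| ≤ R) (hb : |b| ≤ R) :
    |(c₁ * a + c₃ * a ^ 3) - (c₁ * b + c₃ * b ^ 3)| ≤ (c₁ + 3 * c₃ * R ^ 2) * |a - b| := by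
  have hR : 0 ≤ R := (abs_nonneg a).trans ha
  have hfac : (c₁ * a + c₃ * a ^ 3) - (c₁ * b + c₃ * b ^ 3) =
      (c₁ + c₃ * (a ^ 2 + a * b + b ^ 2)) * (a - b) := by ring
  rw [hfac, abs_mul]
  refine mul_le_mul_of_nonneg_right ?_ (abs_nonneg _)
  have ha2 : a ^ 2 ≤ R ^ 2 := by
    rw [← sq_abs]; exact pow_le_pow_left₀ (abs_nonneg a) ha 2
  have hb2 : b ^ 2 ≤ R ^ 2 := by
    rw [← sq_abs]; exact pow_le_pow_left₀ (abs_nonneg b) hb 2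
  have hab : a * b ≤ R ^ 2 := by
    calc a * b ≤ |a * b| := le_abs_self _
      _ = |a| * |b| := abs_mul a b
      _ ≤ R * R := mul_le_mul ha hb (abs_nonneg _) hR
      _ = R ^ 2 := (sq R).symm
  have h0 : 0 ≤ a ^ 2 + a * b + b ^ 2 := by nlinarith [sq_nonneg (a + b), sq_nonneg a, sq_nonneg b]
  have h3 : a ^ 2 + a * b + b ^ 2 ≤ 3 * R ^ 2 := by linarith
  rw [abs_of_nonneg (by positivity)]
  nlinarith

/-- **Lipschitz bound for the force of the pinned chain on a box.** If all positions of `q` and `q'` lie in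
`[-R, R]` and `|q'_j - q_j| ≤ d_j` for a nonnegative `d : ℤ → ℝ`, then
`|∂_iΦ(q') - ∂_iΦ(q)| ≤ (ω₂ + 3 lam R² + 2(1 + 12 β R²)) d_i + (1 + 12 β R²)(d_{i-1} + d_{i+1})`
(`U'(a) - U'(b) = (a - b)(ω₂ + lam(a² + ab + b²))`, `V'(a) - V'(b) = (a - b)(1 + β(a² + ab + b²))`, bonds have
`|q_{j+1} - q_j| ≤ 2R`; absent boundary bonds contribute `0 ≤ (1 + 12βR²) d_{i∓1}`). [folklore] -/
theorem pinnedChain_abs_dPotential_sub_le (hω : 0 ≤ ω₂) (hl : 0 ≤ lam) (hβ : 0 ≤ β) (γ : ℝ) {R : ℝ}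
    {q q' : Fin N → ℝ} (hq : ∀ j, |q j| ≤ R) (hq' : ∀ j, |q' j| ≤ R)
    {d : ℤ → ℝ} (hd0 : ∀ k, 0 ≤ d k) (hd : ∀ j : Fin N, |q' j - q j| ≤ d j) (i : Fin N) :
    |(pinnedChain ω₂ lam β γ).dPotential N i q' - (pinnedChain ω₂ lam β γ).dPotential N i q| ≤
      (ω₂ + 3 * lam * R ^ 2 + 2 * (1 + 12 * β * R ^ 2)) * d i +
        (1 + 12 * β * R ^ 2) * (d (i - 1) + d (i + 1)) := by
  rw [OscillatorChain.dPotential_eq_closed, OscillatorChain.dPotential_eq_closed]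
  simp only [pinnedChain_deriv_U, pinnedChain_deriv_V]
  set KV := 1 + 12 * β * R ^ 2 with hKV_def
  have hR : 0 ≤ R := (abs_nonneg _).trans (hq i)
  have hKV : 0 ≤ KV := by positivity
  -- pinning term
  have hU : |(ω₂ * q' i + lam * q' i ^ 3) - (ω₂ * q i + lam * q i ^ 3)| ≤
      (ω₂ + 3 * lam * R ^ 2) * d i :=
    (abs_cubic_sub_cubic_le hω hl (hq' i) (hq i)).trans
      (mul_le_mul_of_nonneg_left (hd i) (by positivity))
  -- a bond term
  have hV : ∀ j l : Fin N, |(q' l - q' j + β * (q' l - q' j) ^ 3) - (q l - q j + β * (q l - q j) ^ 3)| ≤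
      KV * (d l + d j) := by
    intro j l
    have h2R : ∀ {f : Fin N → ℝ}, (∀ j, |f j| ≤ R) → |f l - f j| ≤ 2 * R := fun hf =>
      (abs_sub _ _).trans (by linarith [hf l, hf j])
    have h := abs_cubic_sub_cubic_le (c₁ := 1) zero_le_one hβ (h2R hq') (h2R hq)
    rw [one_mul, one_mul] at h
    refine h.trans ?_
    have e : (1 + 3 * β * (2 * R) ^ 2) = KV := by rw [hKV_def]; ring
    rw [e]
    refine mul_le_mul_of_nonneg_left ?_ hKV
    calc |q' l - q' j - (q l - q j)| = |(q' l - q l) - (q' j - q j)| := by ring_nf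
      _ ≤ |q' l - q l| + |q' j - q j| := abs_sub _ _
      _ ≤ d l + d j := add_le_add (hd l) (hd j)
  -- left bond
  have hL : |(if h : 0 < i.val then q' i - q' ⟨i.val - 1, by omega⟩ + β * (q' i - q' ⟨i.val - 1, by omega⟩) ^ 3
        else 0) -
      (if h : 0 < i.val then q i - q ⟨i.val - 1, by omega⟩ + β * (q i - q ⟨i.val - 1, by omega⟩) ^ 3
        else 0)| ≤ KV * (d i + d (i - 1)) := by
    by_cases h : 0 < i.val
    · rw [dif_pos h, dif_pos h]
      have h1 := hV ⟨i.val - 1, by omega⟩ i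
      have e : (((⟨i.val - 1, by omega⟩ : Fin N) : ℕ) : ℤ) = (i : ℤ) - 1 := by
        show ((i.val - 1 : ℕ) : ℤ) = (i : ℤ) - 1
        omega
      rwa [e] at h1
    · rw [dif_neg h, dif_neg h, sub_zero, abs_zero]
      exact mul_nonneg hKV (add_nonneg (hd0 _) (hd0 _))
  -- right bond
  have hRb : |(if h : i.val + 1 < N then q' ⟨i.val + 1, h⟩ - q' i + β * (q' ⟨i.val + 1, h⟩ - q' i) ^ 3
        else 0) -
      (if h : i.val + 1 < N then q ⟨i.val + 1, h⟩ - q i + β * (q ⟨i.val + 1, h⟩ - q i) ^ 3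
        else 0)| ≤ KV * (d (i + 1) + d i) := by
    by_cases h : i.val + 1 < N
    · rw [dif_pos h, dif_pos h]
      have h1 := hV i ⟨i.val + 1, h⟩
      have e : (((⟨i.val + 1, h⟩ : Fin N) : ℕ) : ℤ) = (i : ℤ) + 1 := by
        show ((i.val + 1 : ℕ) : ℤ) = (i : ℤ) + 1
        omega
      rwa [e] at h1
    · rw [dif_neg h, dif_neg h, sub_zero, abs_zero]
      exact mul_nonneg hKV (add_nonneg (hd0 _) (hd0 _))
  -- combine
  have key : ∀ (u u' v v' w w' : ℝ), (u' + v' - w') - (u + v - w) = (u' - u) + (v' - v) - (w' - w) := by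
    intros; ring
  rw [key]
  refine (abs_sub _ _).trans ((add_le_add ((abs_add_le _ _).trans (add_le_add hU hL)) hRb).trans ?_)
  nlinarith [hd0 i, hd0 (i - 1), hd0 (i + 1)]

/-- **Lipschitz bound for the momentum drift of the pinned chain on a box**: with `d` dominating the position AND
momentum differences, `|Y(z')_{p,i} - Y(z)_{p,i}| ≤ (ω₂ + 3 lam R² + 2(1 + 12βR²) + 2γ) d_i + (1 + 12βR²)(d_{i-1} + d_{i+1})`
(friction `γ w_i`, `0 ≤ w_i ≤ 2`). [folklore] -/
theorem pinnedChain_abs_drift_snd_sub_le (hω : 0 ≤ ω₂) (hl : 0 ≤ lam) (hβ : 0 ≤ β) (hγ : 0 ≤ γ) {R : ℝ}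
    {z z' : PhaseSpace N} (hq : ∀ j, |z.1 j| ≤ R) (hq' : ∀ j, |z'.1 j| ≤ R)
    {d : ℤ → ℝ} (hd0 : ∀ k, 0 ≤ d k) (hd1 : ∀ j : Fin N, |z'.1 j - z.1 j| ≤ d j)
    (hd2 : ∀ j : Fin N, |z'.2 j - z.2 j| ≤ d j) (i : Fin N) :
    |((pinnedChain ω₂ lam β γ).drift N z').2 i - ((pinnedChain ω₂ lam β γ).drift N z).2 i| ≤
      (ω₂ + 3 * lam * R ^ 2 + 2 * (1 + 12 * β * R ^ 2) + 2 * γ) * d i +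
        (1 + 12 * β * R ^ 2) * (d (i - 1) + d (i + 1)) := by
  rw [pinnedChain_drift_apply, pinnedChain_drift_apply]
  dsimp only
  have hF := pinnedChain_abs_dPotential_sub_le hω hl hβ γ hq hq' hd0 hd1 i
  have hw0 := bathWeight_nonneg N i
  have hw2 := bathWeight_le_two N i
  have hfr : |γ * OscillatorChain.bathWeight N i * z'.2 i - γ * OscillatorChain.bathWeight N i * z.2 i| ≤
      2 * γ * d i := by
    rw [← mul_sub, abs_mul, abs_of_nonneg (mul_nonneg hγ hw0)]
    calc γ * OscillatorChain.bathWeight N i * |z'.2 i - z.2 i| ≤ γ * 2 * d i :=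
          mul_le_mul (mul_le_mul_of_nonneg_left hw2 hγ) (hd2 i) (abs_nonneg _) (by positivity)
      _ = 2 * γ * d i := by ring
  have key : ∀ F F' f f' : ℝ, (-F' - f') - (-F - f) = -((F' - F) + (f' - f)) := by intros; ring
  rw [key, abs_neg]
  refine (abs_add_le _ _).trans ((add_le_add hF hfr).trans (le_of_eq ?_))
  ring

/-! ### Components of the integral equation -/

/-- **Position components of the Langevin integral equation**: `q_i(t) = q_i(0) + ∫₀ᵗ p_i` (the noise acts on
momenta only). [folklore] -/
theorem pinnedChain_chainFlow_fst_apply (hω : 0 < ω₂) (hl : 0 ≤ lam) (hβ : 0 ≤ β) (hγ : 0 ≤ γ) (N : ℕ)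
    (x : PhaseSpace N) {η : ℝ → Fin N → ℝ} (hη : Continuous η) (i : Fin N) {t : ℝ} (ht : 0 ≤ t) :
    ((pinnedChain ω₂ lam β γ).chainFlow N x η t).1 i =
      x.1 i + ∫ s in (0 : ℝ)..t, ((pinnedChain ω₂ lam β γ).chainFlow N x η s).2 i := by
  -- adapted from `pinnedChain_freeFlow_fst_eq` (LangevinChainLaSalle)
  have hzc : Continuous ((pinnedChain ω₂ lam β γ).chainFlow N x η) :=
    pinnedChain_continuous_chainFlow hω hl hβ hγ N x hη
  have hYc : Continuous ((pinnedChain ω₂ lam β γ).drift N) :=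
    (pinnedChain_contDiff_drift ω₂ lam β γ N (n := 0)).continuous
  have hF : IntervalIntegrable (fun s => (pinnedChain ω₂ lam β γ).drift N
      ((pinnedChain ω₂ lam β γ).chainFlow N x η s)) volume 0 t :=
    (hYc.comp hzc).intervalIntegrable 0 t
  have h := pinnedChain_chainFlow_sub_sub_eq_integral hω hl hβ hγ N x hη (T := t) ⟨ht, le_rfl⟩
  have hcomp := ((ContinuousLinearMap.proj (R := ℝ) i).comp
    (ContinuousLinearMap.fst ℝ (Fin N → ℝ) (Fin N → ℝ))).intervalIntegral_comp_comm hF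
  simp only [ContinuousLinearMap.coe_comp, ContinuousLinearMap.coe_fst', Function.comp_apply,
    ContinuousLinearMap.proj_apply] at hcomp
  have h1 := congrArg (fun w : PhaseSpace N => w.1 i) h
  simp only [Prod.fst_sub, Pi.sub_apply, Pi.zero_apply, sub_zero] at h1
  have e : ∫ s in (0 : ℝ)..t, ((pinnedChain ω₂ lam β γ).chainFlow N x η s).2 i =
      (∫ s in (0 : ℝ)..t, (pinnedChain ω₂ lam β γ).drift N ((pinnedChain ω₂ lam β γ).chainFlow N x η s)).1 i :=
    hcomp
  rw [e]
  linarith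

/-- **Momentum components of the Langevin integral equation**: `p_i(t) = p_i(0) + η_i(t) + ∫₀ᵗ Y(z(s))_{p,i}`.
[folklore] -/
theorem pinnedChain_chainFlow_snd_apply (hω : 0 < ω₂) (hl : 0 ≤ lam) (hβ : 0 ≤ β) (hγ : 0 ≤ γ) (N : ℕ)
    (x : PhaseSpace N) {η : ℝ → Fin N → ℝ} (hη : Continuous η) (i : Fin N) {t : ℝ} (ht : 0 ≤ t) :
    ((pinnedChain ω₂ lam β γ).chainFlow N x η t).2 i =
      x.2 i + η t i + ∫ s in (0 : ℝ)..t,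
        ((pinnedChain ω₂ lam β γ).drift N ((pinnedChain ω₂ lam β γ).chainFlow N x η s)).2 i := by
  -- adapted from `pinnedChain_freeFlow_snd_eq` (LangevinChainLaSalle)
  have hzc : Continuous ((pinnedChain ω₂ lam β γ).chainFlow N x η) :=
    pinnedChain_continuous_chainFlow hω hl hβ hγ N x hη
  have hYc : Continuous ((pinnedChain ω₂ lam β γ).drift N) :=
    (pinnedChain_contDiff_drift ω₂ lam β γ N (n := 0)).continuous
  have hF : IntervalIntegrable (fun s => (pinnedChain ω₂ lam β γ).drift N
      ((pinnedChain ω₂ lam β γ).chainFlow N x η s)) volume 0 t :=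
    (hYc.comp hzc).intervalIntegrable 0 t
  have h := pinnedChain_chainFlow_sub_sub_eq_integral hω hl hβ hγ N x hη (T := t) ⟨ht, le_rfl⟩
  have hcomp := ((ContinuousLinearMap.proj (R := ℝ) i).comp
    (ContinuousLinearMap.snd ℝ (Fin N → ℝ) (Fin N → ℝ))).intervalIntegral_comp_comm hF
  simp only [ContinuousLinearMap.coe_comp, ContinuousLinearMap.coe_snd', Function.comp_apply,
    ContinuousLinearMap.proj_apply] at hcomp
  have h1 := congrArg (fun w : PhaseSpace N => w.2 i) h
  simp only [Prod.snd_sub, Pi.sub_apply] at h1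
  rw [← hcomp] at h1
  linarith

/-- Continuity in time of a coordinate of the flow and of the momentum drift along it. [folklore] -/
theorem pinnedChain_continuous_chainFlow_apply (hω : 0 < ω₂) (hl : 0 ≤ lam) (hβ : 0 ≤ β) (hγ : 0 ≤ γ)
    (N : ℕ) (x : PhaseSpace N) {η : ℝ → Fin N → ℝ} (hη : Continuous η) (i : Fin N) :
    (Continuous fun s => ((pinnedChain ω₂ lam β γ).chainFlow N x η s).1 i) ∧
    (Continuous fun s => ((pinnedChain ω₂ lam β γ).chainFlow N x η s).2 i) ∧
    (Continuous fun s =>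
      ((pinnedChain ω₂ lam β γ).drift N ((pinnedChain ω₂ lam β γ).chainFlow N x η s)).2 i) := by
  have hzc := pinnedChain_continuous_chainFlow hω hl hβ hγ N x hη
  have hYc : Continuous ((pinnedChain ω₂ lam β γ).drift N) :=
    (pinnedChain_contDiff_drift ω₂ lam β γ N (n := 0)).continuous
  exact ⟨(continuous_apply i).comp (continuous_fst.comp hzc),
    (continuous_apply i).comp (continuous_snd.comp hzc),
    (continuous_apply i).comp (continuous_snd.comp (hYc.comp hzc))⟩

/-- **The noise cancels in differences**: for two initial data and the SAME noise path,
`δq_i(t) = δq_i(0) + ∫₀ᵗ δp_i` and `δp_i(t) = δp_i(0) + ∫₀ᵗ (Y(z')_{p,i} - Y(z)_{p,i})`. [folklore] -/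
theorem pinnedChain_chainFlow_sub_apply :
    ∀ {ω₂ lam β γ : ℝ}, 0 < ω₂ → 0 ≤ lam → 0 ≤ β → 0 ≤ γ → ∀ (N : ℕ) (x x' : PhaseSpace N) {η : ℝ → Fin N → ℝ},
    Continuous η → ∀ (i : Fin N) {t : ℝ}, 0 ≤ t →
    ((pinnedChain ω₂ lam β γ).chainFlow N x' η t).1 i - ((pinnedChain ω₂ lam β γ).chainFlow N x η t).1 i =
      (x'.1 i - x.1 i) + ∫ s in (0 : ℝ)..t,
        (((pinnedChain ω₂ lam β γ).chainFlow N x' η s).2 i - ((pinnedChain ω₂ lam β γ).chainFlow N x η s).2 i) ∧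
    ((pinnedChain ω₂ lam β γ).chainFlow N x' η t).2 i - ((pinnedChain ω₂ lam β γ).chainFlow N x η t).2 i =
      (x'.2 i - x.2 i) + ∫ s in (0 : ℝ)..t,
        (((pinnedChain ω₂ lam β γ).drift N ((pinnedChain ω₂ lam β γ).chainFlow N x' η s)).2 i -
          ((pinnedChain ω₂ lam β γ).drift N ((pinnedChain ω₂ lam β γ).chainFlow N x η s)).2 i) := by
  intro ω₂ lam β γ hω hl hβ hγ N x x' η hη i t ht
  obtain ⟨-, hc2, hc3⟩ := pinnedChain_continuous_chainFlow_apply hω hl hβ hγ N x hη i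
  obtain ⟨-, hc2', hc3'⟩ := pinnedChain_continuous_chainFlow_apply hω hl hβ hγ N x' hη i
  constructor
  · rw [intervalIntegral.integral_sub (hc2'.intervalIntegrable _ _) (hc2.intervalIntegrable _ _),
      pinnedChain_chainFlow_fst_apply hω hl hβ hγ N x hη i ht,
      pinnedChain_chainFlow_fst_apply hω hl hβ hγ N x' hη i ht]
    ring
  · rw [intervalIntegral.integral_sub (hc3'.intervalIntegrable _ _) (hc3.intervalIntegrable _ _),
      pinnedChain_chainFlow_snd_apply hω hl hβ hγ N x hη i ht,
      pinnedChain_chainFlow_snd_apply hω hl hβ hγ N x' hη i ht]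
    ring

/-! ### The lattice embedding `Fin N ↪ ℤ` of site functions -/

/-- On the chain, the lattice extension of `f` by zero is `f`. [folklore] -/
theorem latticeSum_coe (f : Fin N → ℝ) (i : Fin N) :
    (∑ j : Fin N, if (j : ℤ) = (i : ℤ) then f j else 0) = f i := by
  rw [Finset.sum_eq_single i]
  · rw [if_pos rfl]
  · intro j _ hj
    rw [if_neg]
    exact fun h => hj (Fin.ext (by exact_mod_cast h))
  · exact fun h => (h (Finset.mem_univ i)).elim

/-- Off the chain, the lattice extension vanishes. [folklore] -/
theorem latticeSum_of_forall_ne (f : Fin N → ℝ) {k : ℤ} (hk : ∀ j : Fin N, (j : ℤ) ≠ k) :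
    (∑ j : Fin N, if (j : ℤ) = k then f j else 0) = 0 :=
  Finset.sum_eq_zero fun j _ => if_neg (hk j)

/-- The lattice extension of a nonnegative site function is nonnegative. [folklore] -/
theorem latticeSum_nonneg {f : Fin N → ℝ} (hf : ∀ j, 0 ≤ f j) (k : ℤ) :
    0 ≤ ∑ j : Fin N, if (j : ℤ) = k then f j else 0 :=
  Finset.sum_nonneg fun j _ => by split_ifs <;> [exact hf j; exact le_rfl]

/-- The lattice extension is dominated by any common bound of the (nonnegative) site values. [folklore] -/
theorem latticeSum_le {f : Fin N → ℝ} {B : ℝ} (hB : 0 ≤ B) (hf : ∀ j, f j ≤ B) (k : ℤ) :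
    (∑ j : Fin N, if (j : ℤ) = k then f j else 0) ≤ B := by
  by_cases h : ∃ j : Fin N, (j : ℤ) = k
  · obtain ⟨j, rfl⟩ := h
    rw [latticeSum_coe]
    exact hf j
  · push Not at h
    rw [latticeSum_of_forall_ne f h]
    exact hB

end LightConePropagation

end Summit.AtomisticToContinuum.FouriersLaw.Theorems.NonBallistic
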